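/-
Copyright (c) 2026 the pub-hodgecm-mathlib formalisation cell (harness21).  Prover seat hodgecm-mathlib-K2E4-p14 (g8), Track B ∕ K2-LIT, h413 = `stmt-HodgeConjecture-24833`,
line `K2_E1_TraceFormulaBeta`, campaign «EIS-R7-BL-SPH-3», deal (133)∕(165) of the dealer K2E1-plan (g7) «capstone₃ LETTER-FREE ASSEMBLY», FILE A (per K2E4-p10 (g6)'s
`K2/K2E4-p10/g6/HANDOFF-g6-to-g7.K2E4-p10-g6.md` steps 4–6): the (L4) glue ★ p859836 `K2E1SphericalEisensteinRegularRemainderCMThreeOfExports` RE-RUN ON AN ABSTRACT DOMAIN `D`.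
-/
import Summits.HodgeConjecture.HodgeConjecture.Theorems.K2E1SphericalEisensteinRegularRemainderCMThreeOfExports   -- ★ p859836 (K2E4-p10 g6): the (L4) glue on `{1<re} ∖ P`; brings ★ p859768, ★ p859801, ★ p859663, ★ P5b, ★ p859595
import HarnessLib

/-!
# K2·E1 — `K2E1SphericalEisensteinRegularRemainderCMThreeOnDomain` ((L4) glue at `U(2,1)_{L/L⁺}` ON A BALL DOMAIN): FROM THE EXPORTS₃ DATA RESTRICTED TO AN OPEN PRECONNECTED `D`,
# THE OPERATOR ROAD'S `L²` FAMILY ON `D` AND ITS TWO `L²` BOUNDS, TO `hres` (`Res_{z=2}Ẽ(z)(g) = φ₀r`) AND `hbdd` (pointwise pole exclusion)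

Track B ∕ K2-LIT, crux h413 = `stmt-HodgeConjecture-24833`, route of record `HCCMUnconditional`; cell `hodgecm-mathlib`, squad K2, ENGINE E1, campaign EIS-R7-BL-SPH-3.  THEOREMS ONLY
(no `def`, no `instance`, no notation, no named-fact hypothesis, no `sorry`); lane `--supports stmt-HodgeConjecture-24833 --as helper` (count-neutral).  Closes no socket.

WHY.  ★ p859836 `hres_and_hbdd_cm_three_of_exports` hard-codes the domain `D = {1 < re} ∖ P` and therefore asks for the operator road's truncated `L²` family `Fam` on the WHOLE punctured
half-plane — but the closer₃ (★ K2E1-p11 `exists_truncatedFamily_cm_three`) delivers `Fam` only on the holomorphy set `U n ∖ P` of ONE Bernstein–Lapid ball, at that ball's own level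
`T₀`.  K2E4-p10's (133) plan therefore runs the glue on the BALL DOMAIN `D := ({1 < re} ∩ ball 0 (n+2) ∩ U n) ∖ (P ∪ {2})`.  Every brick the glue uses (★ p859663 (Hk)∕(E3′) continued, ★
p859801 `exists_analyticAt_eventuallyEq_sub_mul_of_family_bound` ∕ `exists_eventually_norm_le_of_family_bound`, ★ p859494 §1, ★ p859768 `exists_analyticAt_remainder_cm_three`) is ALREADY
stated for an abstract open preconnected `D` carrying (i) a tube point `σ₀ > 2` with a neighbourhood in `D` and (ii) a punctured ball around `2` in `D`; this file is ★ p859836's proof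
VERBATIM with the `P`-shaped hypotheses replaced by exactly that abstract `D`-data, split into the two heads the assembly consumes separately (they live on different balls):
* §1 **`hres_cm_three_on_domain`** — `D` open preconnected, `D ⊆ {1<re} ∖ {2}`, `σ₀`-tube point, punctured `ρ`-ball at `2`; the EXPORTS letters ON `D` ((E1) `hEd`, (E4), (E2-bd),
  left-`G(L⁺)`-invariance, tube agreement); the coefficient `cc` holomorphic on `{1<re}∖{2}` with `(z−2)cc(z) → r` and the tube constant term; `Fam` holomorphic on `D` with
  `Fam z =ᵐ Λ^T Ẽ(z)` at ONE level `T ≥ 1`; the Maass–Selberg bound `hMS2 : ‖(z−2)•Fam z‖ ≤ C` near `2` ⇒ `∀ g, ∃ G` analytic at `2`, `G =ᶠ[𝓝[≠] 2] (Ẽ(·)(g) − φ₀(H^z + cc·H^{2−z}))`.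
* §2 **`hbdd_cm_three_on_domain`** — the same `D`-data WITHOUT the punctured ball at `2`, a point `z₀` (`1 < re z₀`, `z₀ ≠ 2`) with `∀ᶠ z in 𝓝[≠] z₀, z ∈ D`, and the `L²` pole exclusion
  `hMSP : ‖Fam z‖ ≤ C` near `z₀` ⇒ `∀ g, ∃ C, ∀ᶠ z in 𝓝[≠] z₀, ‖Ẽ(z)(g)‖ ≤ C`.
HONEST LABEL: HC_CM is proved only modulo the 7 printed citations (2 remaining named inputs: hLiu418 = `stmt-HodgeConjecture-24832`, h413 = `stmt-HodgeConjecture-24833`) until rung 0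
closes; this file asserts no named fact and closes no socket; both heads are CONDITIONAL on exactly the letters listed (the MS letters `hMS2`∕`hMSP` stay visible).
References: [MoeglinWaldspurger1995] IV.1.9–IV.1.11 · [Langlands1976] §7 · [BernsteinLapid2019] §4 p. 10 · [Garrett2018] §2.10–§2.11.
-/

set_option autoImplicit false
-- the mandated namespace repeats the single-problem summit's segment (`HodgeConjecture.HodgeConjecture`)
set_option linter.dupNamespace false

noncomputable section

open MeasureTheory Measure NumberField IsDedekindDomain Set Filter Topology Metric
open scoped ENNReal NNReal
open Literature.NumberTheory.Automorphic Literature.NumberTheory.Automorphic.UnitaryGroup AdelicGroupData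
open Summit.HodgeConjecture.HodgeConjecture.Cruxes.H413.K2E1BorelEisensteinU
open Summit.HodgeConjecture.HodgeConjecture.Cruxes.H413.K2E1SphericalEisensteinResidueLinkU (exists_tendsto_smul_sub_of_eventually_norm_le)
open Summit.HodgeConjecture.HodgeConjecture.Cruxes.H413.K2E1SphericalHeckeEigenSectionU2 (differentiable_integral_mul_borelHeight_cpow_cm)
open Summit.HodgeConjecture.HodgeConjecture.Cruxes.H413.K2E1ContinuedEisensteinHeckeConstantTermCMThree (integral_mul_continued_eq_cm_three borelConstantTerm_continued_eq_cm_three)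
open Summit.HodgeConjecture.HodgeConjecture.Cruxes.H413.K2E1SphericalEisensteinHeckeLinkFixedLevelUThree (exists_eventually_norm_le_of_family_bound exists_analyticAt_eventuallyEq_sub_mul_of_family_bound)
open Summit.HodgeConjecture.HodgeConjecture.Cruxes.H413.K2E1SphericalEisensteinResidueCuspidalCMThree (exists_analyticAt_remainder_cm_three)
open Summit.HodgeConjecture.HodgeConjecture.Cruxes.H413.K2E1BLUniquenessU2 (exists_biInvariant_one_pos_re_integral_pos)

namespace Summit.HodgeConjecture.HodgeConjecture.Cruxes.H413.K2E1SphericalEisensteinRegularRemainderCMThreeOnDomain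

variable (L : Type) [Field L] [NumberField L] [IsCMField L]
variable [MeasurableSpace (quasiSplit (↥(maximalRealSubfield L)) L (IsCMField.complexConj L) 3).Adelic] [BorelSpace (quasiSplit (↥(maximalRealSubfield L)) L (IsCMField.complexConj L) 3).Adelic]

/-! ## §1 `hres` on a ball domain: the remainder extends across `z = 2` -/

/-- **`hres` ON AN ABSTRACT DOMAIN** (★ p859836 `hres_and_hbdd_cm_three_of_exports` (i), with `D` abstract).  Data: `D` open preconnected, `D ⊆ {1 < re} ∖ {2}`, a tube point `σ₀ > 2` with a
neighbourhood in `D`, a punctured ball `B(2,ρ) ∖ {2} ⊆ D`; the EXPORTS letters ON `D` ((E1) `hEd`, (E4), (E2-bd), left-`G(L⁺)`-invariance, tube agreement (E2)); the coefficient `cc` holomorphic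
on `{1<re} ∖ {2}` with `(z−2)·cc(z) → r` and the tube constant term `E(φ₀H^z)_B = φ₀(H^z + cc(z)H^{2−z})`; the operator road's family `Fam` holomorphic on `D` with `Fam z =ᵐ Λ^T Ẽ(z)` at ONE
level `T ≥ 1`; and the Maass–Selberg bound `‖(z−2)•Fam z‖ ≤ C` near `2`.  THEN for every `g`, `Ẽ(z)(g) − φ₀(H(g)^z + cc(z)H(g)^{2−z})` extends analytically across `2`.
[cite: MoeglinWaldspurger1995, IV.1.11] [cite: Langlands1976, §7] [cite: BernsteinLapid2019, §4 p. 10] -/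
theorem hres_cm_three_on_domain
    (μ : Measure (quasiSplit (↥(maximalRealSubfield L)) L (IsCMField.complexConj L) 3).automorphicQuotient) [(quasiSplit (↥(maximalRealSubfield L)) L (IsCMField.complexConj L) 3).IsAutomorphicMeasure μ]
    (ν : Measure ↥(adelicUnipotent (↥(maximalRealSubfield L)) L (IsCMField.complexConj L) 3)) [ν.IsHaarMeasure]
    {𝓕 : Set ↥(adelicUnipotent (↥(maximalRealSubfield L)) L (IsCMField.complexConj L) 3)}
    (h𝓕N : IsFundamentalDomain ↥(rationalUnipotent (↥(maximalRealSubfield L)) L (IsCMField.complexConj L) 3) 𝓕 ν) (h𝓕c : IsCompact (closure 𝓕))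
    (φ₀ : ℂ) {T : ℝ≥0} (hT : 1 ≤ T)
    (Ec : ℂ → (quasiSplit (↥(maximalRealSubfield L)) L (IsCMField.complexConj L) 3).Adelic → ℂ) {D : Set ℂ} (hDo : IsOpen D) (hDc : IsPreconnected D) (hD1 : D ⊆ {z : ℂ | 1 < z.re} \ {2})
    {σ₀ : ℝ} (hσ₀ : 2 < σ₀) (hσD : ∀ᶠ z in 𝓝 ((σ₀ : ℝ) : ℂ), z ∈ D) {ρ : ℝ} (hρ : 0 < ρ) (hρD : ∀ z : ℂ, z ≠ 2 → dist z 2 < ρ → z ∈ D)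
    (hEd : ∀ g, DifferentiableOn ℂ (fun z => Ec z g) D) (hE4 : ∀ z ∈ D, Continuous (Ec z))
    (hEbd : ∀ z₀ ∈ D, ∀ K : Set (quasiSplit (↥(maximalRealSubfield L)) L (IsCMField.complexConj L) 3).Adelic, IsCompact K → ∃ V ∈ 𝓝 z₀, ∃ M : ℝ, ∀ z ∈ V, ∀ g ∈ K, ‖Ec z g‖ ≤ M)
    (hEcinv : ∀ z ∈ D, ∀ (γ : (quasiSplit (↥(maximalRealSubfield L)) L (IsCMField.complexConj L) 3).arithmeticSubgroup) (x : (quasiSplit (↥(maximalRealSubfield L)) L (IsCMField.complexConj L) 3).Adelic), Ec z ((γ : (quasiSplit (↥(maximalRealSubfield L)) L (IsCMField.complexConj L) 3).Adelic) * x) = Ec z x)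
    (hE2 : ∀ z ∈ D, 2 < z.re → Ec z = eisensteinSeriesU (flatSectionU (fun _ : (quasiSplit (↥(maximalRealSubfield L)) L (IsCMField.complexConj L) 3).Adelic => φ₀) z))
    {cc : ℂ → ℂ} (hchol : DifferentiableOn ℂ cc ({z : ℂ | 1 < z.re} \ {2})) {r : ℂ} (hcres : Tendsto (fun z : ℂ => (z - 2) * cc z) (𝓝[≠] 2) (𝓝 r))
    (hccE : ∀ z : ℂ, 2 < z.re → ∀ g : (quasiSplit (↥(maximalRealSubfield L)) L (IsCMField.complexConj L) 3).Adelic,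
      borelConstantTerm ν 𝓕 (eisensteinSeriesU (flatSectionU (fun _ : (quasiSplit (↥(maximalRealSubfield L)) L (IsCMField.complexConj L) 3).Adelic => φ₀) z)) g =
        φ₀ * ((((borelHeight g : ℝ≥0) : ℝ) : ℂ) ^ z + cc z * (((borelHeight g : ℝ≥0) : ℝ) : ℂ) ^ (2 - z)))
    (Fam : ℂ → (quasiSplit (↥(maximalRealSubfield L)) L (IsCMField.complexConj L) 3).L2 μ) (hFd : DifferentiableOn ℂ Fam D)
    (hFam : ∀ z ∈ D, ((Fam z : (quasiSplit (↥(maximalRealSubfield L)) L (IsCMField.complexConj L) 3).L2 μ) : (quasiSplit (↥(maximalRealSubfield L)) L (IsCMField.complexConj L) 3).automorphicQuotient → ℂ) =ᵐ[μ] (quasiSplit (↥(maximalRealSubfield L)) L (IsCMField.complexConj L) 3).quotFun (truncation ν 𝓕 T (Ec z)))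
    (hMS2 : ∃ C : ℝ, ∀ᶠ z in 𝓝[≠] (2 : ℂ), ‖(z - 2) • Fam z‖ ≤ C) :
    ∀ g : (quasiSplit (↥(maximalRealSubfield L)) L (IsCMField.complexConj L) 3).Adelic, ∃ G : ℂ → ℂ, AnalyticAt ℂ G 2 ∧ G =ᶠ[𝓝[≠] 2] (fun z => Ec z g -
      φ₀ * ((((borelHeight g : ℝ≥0) : ℝ) : ℂ) ^ z + cc z * (((borelHeight g : ℝ≥0) : ℝ) : ℂ) ^ ((2 : ℂ) - z))) := by
  haveI := t2Space_adeleRing_of_numberField L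
  haveI := locallyCompactSpace_adeleRing' L
  haveI := secondCountableTopology_adeleRing L
  haveI : T2Space (quasiSplit (↥(maximalRealSubfield L)) L (IsCMField.complexConj L) 3).Adelic := inferInstanceAs (T2Space (adelic (↥(maximalRealSubfield L)) L (IsCMField.complexConj L) 3 ((StdForm.antidiagonal 3).over L)))
  haveI : LocallyCompactSpace (quasiSplit (↥(maximalRealSubfield L)) L (IsCMField.complexConj L) 3).Adelic := inferInstanceAs (LocallyCompactSpace (adelic (↥(maximalRealSubfield L)) L (IsCMField.complexConj L) 3 ((StdForm.antidiagonal 3).over L)))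
  haveI : SecondCountableTopology (quasiSplit (↥(maximalRealSubfield L)) L (IsCMField.complexConj L) 3).Adelic := inferInstanceAs (SecondCountableTopology (adelic (↥(maximalRealSubfield L)) L (IsCMField.complexConj L) 3 ((StdForm.antidiagonal 3).over L)))
  haveI : (haar : Measure (quasiSplit (↥(maximalRealSubfield L)) L (IsCMField.complexConj L) 3).Adelic).IsMulRightInvariant := forall_isHaarMeasure_isMulRightInvariant_quasiSplit_cm L (by norm_num : 2 ≤ 3) haar inferInstance
  haveI : (haar : Measure (quasiSplit (↥(maximalRealSubfield L)) L (IsCMField.complexConj L) 3).Adelic).IsInvInvariant := isInvInvariant_of_isMulRightInvariant _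
  -- a test function at a point (★ P5b, as in ★ p859836): continuous, compactly supported, left-`K_U`-invariant, `ĥ(z₀) ≠ 0`, `ĥ` continuous
  have htest : ∀ z₀ : ℂ, ∃ h : (quasiSplit (↥(maximalRealSubfield L)) L (IsCMField.complexConj L) 3).Adelic → ℝ, Continuous h ∧ HasCompactSupport h ∧
      (∀ k : (quasiSplit (↥(maximalRealSubfield L)) L (IsCMField.complexConj L) 3).Adelic, adelicVal (↥(maximalRealSubfield L)) L (IsCMField.complexConj L) 3 ((StdForm.antidiagonal 3).over L) k ∈ standardMaximalCompactGL 3 L → ∀ x, h (k * x) = h x) ∧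
      ContinuousAt (fun z : ℂ => ∫ x, ((h x : ℝ) : ℂ) * (((borelHeight x : ℝ≥0) : ℝ) : ℂ) ^ z ∂haar) z₀ ∧
      (∫ x, ((h x : ℝ) : ℂ) * (((borelHeight x : ℝ≥0) : ℝ) : ℂ) ^ z₀ ∂haar) ≠ 0 := by
    intro z₀
    obtain ⟨h, hh, hhc, -, hK, -, hre⟩ := exists_biInvariant_one_pos_re_integral_pos (haar : Measure (quasiSplit (↥(maximalRealSubfield L)) L (IsCMField.complexConj L) 3).Adelic) z₀
    refine ⟨h, hh, hhc, fun k hk x => ?_, ?_, fun h0 => ?_⟩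
    · have := hK k 1 hk (by rw [map_one]; exact one_mem _) x
      rwa [mul_one] at this
    · exact ((differentiable_integral_mul_borelHeight_cpow_cm L haar (Complex.continuous_ofReal.comp hh) (hhc.comp_left Complex.ofReal_zero)).continuous).continuousAt
    · rw [h0, Complex.zero_re] at hre
      exact lt_irrefl _ hre
  -- the punctured ball around `2` inside `D`
  have hD2 : ∀ᶠ z in 𝓝[≠] (2 : ℂ), z ∈ D := by
    filter_upwards [inter_mem_nhdsWithin _ (ball_mem_nhds (2 : ℂ) hρ)] with z hz
    exact hρD z hz.1 (mem_ball.1 hz.2)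
  -- the coefficient on `D` and the continued constant term (E3′) on `D`
  have hcc : DifferentiableOn ℂ cc D := hchol.mono hD1
  have hE3 := borelConstantTerm_continued_eq_cm_three L ν h𝓕N h𝓕c φ₀ Ec hDo hDc hσ₀ hσD hEd hE4 hEbd hE2 hcc (fun z _ hz g => hccE z hz g)
  -- `(z−2)cc(z)` is bounded near `2`
  have hcc2 : ∃ C : ℝ, ∀ᶠ z in 𝓝[≠] (2 : ℂ), ‖(z - 2) * cc z‖ ≤ C :=
    ⟨‖r‖ + 1, (hcres.norm.eventually (gt_mem_nhds (lt_add_one ‖r‖))).mono fun z hz => hz.le⟩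
  -- (Hk) continued on `D` for a test function
  have hHk : ∀ {h : (quasiSplit (↥(maximalRealSubfield L)) L (IsCMField.complexConj L) 3).Adelic → ℝ}, Continuous h → HasCompactSupport h → (∀ k : (quasiSplit (↥(maximalRealSubfield L)) L (IsCMField.complexConj L) 3).Adelic, adelicVal (↥(maximalRealSubfield L)) L (IsCMField.complexConj L) 3 ((StdForm.antidiagonal 3).over L) k ∈ standardMaximalCompactGL 3 L → ∀ x, h (k * x) = h x) →
      ∀ z ∈ D, ∀ g : (quasiSplit (↥(maximalRealSubfield L)) L (IsCMField.complexConj L) 3).Adelic, ∫ y, ((h y : ℝ) : ℂ) * Ec z (g * y) ∂haar = (∫ x, ((h x : ℝ) : ℂ) * (((borelHeight x : ℝ≥0) : ℝ) : ℂ) ^ z ∂haar) * Ec z g :=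
    fun hh hhc hK => integral_mul_continued_eq_cm_three L haar hK hh hhc φ₀ Ec hDo hDc hσ₀ hσD hEd hE4 hEbd hE2
  -- a test function at `2`, the simple-pole letter (F) from `hMS2`, then the residue ★ p859768
  obtain ⟨h, hh, hhc, hK, hha, hha0⟩ := htest 2
  have hEd2 : ∀ g : (quasiSplit (↥(maximalRealSubfield L)) L (IsCMField.complexConj L) 3).Adelic, ∀ᶠ z in 𝓝[≠] (2 : ℂ), DifferentiableAt ℂ (fun z => Ec z g) z :=
    fun g => hD2.mono fun z hz => (hEd g).differentiableAt (hDo.mem_nhds hz)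
  have hFp := fun g => (exists_analyticAt_eventuallyEq_sub_mul_of_family_bound μ haar ν h𝓕N hT φ₀ hh hhc hha hha0 Ec hD2 hEcinv (hHk hh hhc hK) cc hE3 Fam hFam hcc2 hMS2 hEd2 g).2
  choose Fp hF hFE using hFp
  obtain ⟨Res, hRes⟩ := exists_tendsto_smul_sub_of_eventually_norm_le (hD2.mono fun z hz => hFd.differentiableAt (hDo.mem_nhds hz)) hMS2
  exact exists_analyticAt_remainder_cm_three L μ ν h𝓕N h𝓕c φ₀ hT Ec hDo hDc hσ₀ hσD hρ hρD hEd hE4 hEbd hEcinv hE2 hchol hcres hE3 Fp hF hFE Fam hFd hFam Res hRes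

/-! ## §2 `hbdd` on a ball domain: pointwise pole exclusion off `z = 2` -/

/-- **`hbdd` ON AN ABSTRACT DOMAIN** (★ p859836 `hres_and_hbdd_cm_three_of_exports` (ii), with `D` abstract).  Data: `D` open preconnected, `D ⊆ {1 < re} ∖ {2}`, a tube point `σ₀ > 2`
with a neighbourhood in `D`; the EXPORTS letters ON `D`; `cc` holomorphic on `{1<re} ∖ {2}` with the tube constant term; `Fam` with `Fam z =ᵐ Λ^T Ẽ(z)` on `D` at ONE level
`T ≥ 1`; a point `z₀` (`1 < re z₀`, `z₀ ≠ 2`) with `∀ᶠ z in 𝓝[≠] z₀, z ∈ D`, and the `L²` pole exclusion `‖Fam z‖ ≤ C` near `z₀`.  THEN for every `g`, `Ẽ(z)(g)` is bounded on a punctured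
neighbourhood of `z₀`. [cite: MoeglinWaldspurger1995, IV.1.11] [cite: Langlands1976, §7] [cite: BernsteinLapid2019, §4 p. 10] -/
theorem hbdd_cm_three_on_domain
    (μ : Measure (quasiSplit (↥(maximalRealSubfield L)) L (IsCMField.complexConj L) 3).automorphicQuotient) [(quasiSplit (↥(maximalRealSubfield L)) L (IsCMField.complexConj L) 3).IsAutomorphicMeasure μ]
    (ν : Measure ↥(adelicUnipotent (↥(maximalRealSubfield L)) L (IsCMField.complexConj L) 3)) [ν.IsHaarMeasure]
    {𝓕 : Set ↥(adelicUnipotent (↥(maximalRealSubfield L)) L (IsCMField.complexConj L) 3)}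
    (h𝓕N : IsFundamentalDomain ↥(rationalUnipotent (↥(maximalRealSubfield L)) L (IsCMField.complexConj L) 3) 𝓕 ν) (h𝓕c : IsCompact (closure 𝓕))
    (φ₀ : ℂ) {T : ℝ≥0} (hT : 1 ≤ T)
    (Ec : ℂ → (quasiSplit (↥(maximalRealSubfield L)) L (IsCMField.complexConj L) 3).Adelic → ℂ) {D : Set ℂ} (hDo : IsOpen D) (hDc : IsPreconnected D) (hD1 : D ⊆ {z : ℂ | 1 < z.re} \ {2})
    {σ₀ : ℝ} (hσ₀ : 2 < σ₀) (hσD : ∀ᶠ z in 𝓝 ((σ₀ : ℝ) : ℂ), z ∈ D)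
    (hEd : ∀ g, DifferentiableOn ℂ (fun z => Ec z g) D) (hE4 : ∀ z ∈ D, Continuous (Ec z))
    (hEbd : ∀ z₀ ∈ D, ∀ K : Set (quasiSplit (↥(maximalRealSubfield L)) L (IsCMField.complexConj L) 3).Adelic, IsCompact K → ∃ V ∈ 𝓝 z₀, ∃ M : ℝ, ∀ z ∈ V, ∀ g ∈ K, ‖Ec z g‖ ≤ M)
    (hEcinv : ∀ z ∈ D, ∀ (γ : (quasiSplit (↥(maximalRealSubfield L)) L (IsCMField.complexConj L) 3).arithmeticSubgroup) (x : (quasiSplit (↥(maximalRealSubfield L)) L (IsCMField.complexConj L) 3).Adelic), Ec z ((γ : (quasiSplit (↥(maximalRealSubfield L)) L (IsCMField.complexConj L) 3).Adelic) * x) = Ec z x)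
    (hE2 : ∀ z ∈ D, 2 < z.re → Ec z = eisensteinSeriesU (flatSectionU (fun _ : (quasiSplit (↥(maximalRealSubfield L)) L (IsCMField.complexConj L) 3).Adelic => φ₀) z))
    {cc : ℂ → ℂ} (hchol : DifferentiableOn ℂ cc ({z : ℂ | 1 < z.re} \ {2}))
    (hccE : ∀ z : ℂ, 2 < z.re → ∀ g : (quasiSplit (↥(maximalRealSubfield L)) L (IsCMField.complexConj L) 3).Adelic,
      borelConstantTerm ν 𝓕 (eisensteinSeriesU (flatSectionU (fun _ : (quasiSplit (↥(maximalRealSubfield L)) L (IsCMField.complexConj L) 3).Adelic => φ₀) z)) g =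
        φ₀ * ((((borelHeight g : ℝ≥0) : ℝ) : ℂ) ^ z + cc z * (((borelHeight g : ℝ≥0) : ℝ) : ℂ) ^ (2 - z)))
    (Fam : ℂ → (quasiSplit (↥(maximalRealSubfield L)) L (IsCMField.complexConj L) 3).L2 μ)
    (hFam : ∀ z ∈ D, ((Fam z : (quasiSplit (↥(maximalRealSubfield L)) L (IsCMField.complexConj L) 3).L2 μ) : (quasiSplit (↥(maximalRealSubfield L)) L (IsCMField.complexConj L) 3).automorphicQuotient → ℂ) =ᵐ[μ] (quasiSplit (↥(maximalRealSubfield L)) L (IsCMField.complexConj L) 3).quotFun (truncation ν 𝓕 T (Ec z)))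
    {z₀ : ℂ} (hz₀ : 1 < z₀.re) (hz₀2 : z₀ ≠ 2) (hS : ∀ᶠ z in 𝓝[≠] z₀, z ∈ D) (hMSP : ∃ C : ℝ, ∀ᶠ z in 𝓝[≠] z₀, ‖Fam z‖ ≤ C) :
    ∀ g : (quasiSplit (↥(maximalRealSubfield L)) L (IsCMField.complexConj L) 3).Adelic, ∃ C : ℝ, ∀ᶠ z in 𝓝[≠] z₀, ‖Ec z g‖ ≤ C := by
  haveI := t2Space_adeleRing_of_numberField L
  haveI := locallyCompactSpace_adeleRing' L
  haveI := secondCountableTopology_adeleRing L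
  haveI : T2Space (quasiSplit (↥(maximalRealSubfield L)) L (IsCMField.complexConj L) 3).Adelic := inferInstanceAs (T2Space (adelic (↥(maximalRealSubfield L)) L (IsCMField.complexConj L) 3 ((StdForm.antidiagonal 3).over L)))
  haveI : LocallyCompactSpace (quasiSplit (↥(maximalRealSubfield L)) L (IsCMField.complexConj L) 3).Adelic := inferInstanceAs (LocallyCompactSpace (adelic (↥(maximalRealSubfield L)) L (IsCMField.complexConj L) 3 ((StdForm.antidiagonal 3).over L)))
  haveI : SecondCountableTopology (quasiSplit (↥(maximalRealSubfield L)) L (IsCMField.complexConj L) 3).Adelic := inferInstanceAs (SecondCountableTopology (adelic (↥(maximalRealSubfield L)) L (IsCMField.complexConj L) 3 ((StdForm.antidiagonal 3).over L)))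
  haveI : (haar : Measure (quasiSplit (↥(maximalRealSubfield L)) L (IsCMField.complexConj L) 3).Adelic).IsMulRightInvariant := forall_isHaarMeasure_isMulRightInvariant_quasiSplit_cm L (by norm_num : 2 ≤ 3) haar inferInstance
  haveI : (haar : Measure (quasiSplit (↥(maximalRealSubfield L)) L (IsCMField.complexConj L) 3).Adelic).IsInvInvariant := isInvInvariant_of_isMulRightInvariant _
  -- a test function at a point (★ P5b, as in ★ p859836): continuous, compactly supported, left-`K_U`-invariant, `ĥ(z₀) ≠ 0`, `ĥ` continuous
  have htest : ∀ z₀ : ℂ, ∃ h : (quasiSplit (↥(maximalRealSubfield L)) L (IsCMField.complexConj L) 3).Adelic → ℝ, Continuous h ∧ HasCompactSupport h ∧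
      (∀ k : (quasiSplit (↥(maximalRealSubfield L)) L (IsCMField.complexConj L) 3).Adelic, adelicVal (↥(maximalRealSubfield L)) L (IsCMField.complexConj L) 3 ((StdForm.antidiagonal 3).over L) k ∈ standardMaximalCompactGL 3 L → ∀ x, h (k * x) = h x) ∧
      ContinuousAt (fun z : ℂ => ∫ x, ((h x : ℝ) : ℂ) * (((borelHeight x : ℝ≥0) : ℝ) : ℂ) ^ z ∂haar) z₀ ∧
      (∫ x, ((h x : ℝ) : ℂ) * (((borelHeight x : ℝ≥0) : ℝ) : ℂ) ^ z₀ ∂haar) ≠ 0 := by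
    intro z₀
    obtain ⟨h, hh, hhc, -, hK, -, hre⟩ := exists_biInvariant_one_pos_re_integral_pos (haar : Measure (quasiSplit (↥(maximalRealSubfield L)) L (IsCMField.complexConj L) 3).Adelic) z₀
    refine ⟨h, hh, hhc, fun k hk x => ?_, ?_, fun h0 => ?_⟩
    · have := hK k 1 hk (by rw [map_one]; exact one_mem _) x
      rwa [mul_one] at this
    · exact ((differentiable_integral_mul_borelHeight_cpow_cm L haar (Complex.continuous_ofReal.comp hh) (hhc.comp_left Complex.ofReal_zero)).continuous).continuousAt
    · rw [h0, Complex.zero_re] at hre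
      exact lt_irrefl _ hre
  -- the coefficient on `D`, the continued constant term (E3′) on `D`, `cc` bounded near `z₀`
  have hcc : DifferentiableOn ℂ cc D := hchol.mono hD1
  have hE3 := borelConstantTerm_continued_eq_cm_three L ν h𝓕N h𝓕c φ₀ Ec hDo hDc hσ₀ hσD hEd hE4 hEbd hE2 hcc (fun z _ hz g => hccE z hz g)
  have hccb : ∃ C : ℝ, ∀ᶠ z in 𝓝[≠] z₀, ‖cc z‖ ≤ C := by
    have hca : ContinuousAt cc z₀ :=
      (hchol.differentiableAt (((isOpen_lt continuous_const Complex.continuous_re).sdiff isClosed_singleton).mem_nhds ⟨hz₀, hz₀2⟩)).continuousAt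
    exact ⟨‖cc z₀‖ + 1, mem_nhdsWithin_of_mem_nhds ((hca.norm.eventually (gt_mem_nhds (lt_add_one ‖cc z₀‖))).mono fun z hz => hz.le)⟩
  -- (Hk) continued on `D` for a test function at `z₀`
  have hHk : ∀ {h : (quasiSplit (↥(maximalRealSubfield L)) L (IsCMField.complexConj L) 3).Adelic → ℝ}, Continuous h → HasCompactSupport h → (∀ k : (quasiSplit (↥(maximalRealSubfield L)) L (IsCMField.complexConj L) 3).Adelic, adelicVal (↥(maximalRealSubfield L)) L (IsCMField.complexConj L) 3 ((StdForm.antidiagonal 3).over L) k ∈ standardMaximalCompactGL 3 L → ∀ x, h (k * x) = h x) →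
      ∀ z ∈ D, ∀ g : (quasiSplit (↥(maximalRealSubfield L)) L (IsCMField.complexConj L) 3).Adelic, ∫ y, ((h y : ℝ) : ℂ) * Ec z (g * y) ∂haar = (∫ x, ((h x : ℝ) : ℂ) * (((borelHeight x : ℝ≥0) : ℝ) : ℂ) ^ z ∂haar) * Ec z g :=
    fun hh hhc hK => integral_mul_continued_eq_cm_three L haar hK hh hhc φ₀ Ec hDo hDc hσ₀ hσD hEd hE4 hEbd hE2
  obtain ⟨h, hh, hhc, hK, hha, hha0⟩ := htest z₀
  exact exists_eventually_norm_le_of_family_bound μ haar ν h𝓕N hT φ₀ hh hhc hha hha0 Ec hS hEcinv (hHk hh hhc hK) cc hE3 Fam hFam hccb hMSP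

end Summit.HodgeConjecture.HodgeConjecture.Cruxes.H413.K2E1SphericalEisensteinRegularRemainderCMThreeOnDomain

end
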